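import Summits.SmoothPoincare4.SmoothPoincare4.Theses.SymplecticOrigami
import Summits.SmoothPoincare4.SmoothPoincare4.Theses.SchoenfliesSplit
import Literature.Topology.FourManifolds.CerfGammaFourProofs
import Literature.Topology.FourManifolds.BallGluingUniqueness
import Literature.Topology.FourManifolds.RadialExtension
import Literature.Topology.FourManifolds.CerfTheoremOne
import Literature.Topology.FourManifolds.SmoothOrientationSphereProofs
import Literature.Topology.FourManifolds.SmoothOrientationDiffeomorphProofs
import Literature.Topology.FourManifolds.OrientationDiffeotopy
import Literature.Topology.FourManifolds.ClosedBallSmoothMaps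
import Literature.Geometry.Symplectic.GromovR4RelEndProofs
import HarnessLib

/-!
# Line `contact-cone-gromov-relend` — skeleton for crux `SchsplitCerf` / `CerfGammaFour` (Γ₄ = 0)

Crux item stmt-SmoothPoincare4-8758 (FIXED, never restated): `SchoenfliesSplit.SchsplitCerf` =
`SymplecticOrigami.CerfGammaFour` = `EuclideanOrigami.SchsplitCerf` = VERBATIM the tree's named fact
`Literature.Topology.FourManifolds.cerf_twistedSphere_four` (every twisted 4-sphere `𝔻⁴ ∪_φ 𝔻⁴` is
diffeomorphic to `𝕊⁴`; Cerf 1968, `Γ₄ = 0`).  Primary route: `route-SmoothPoincare4-SymplecticOrigami`;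
also wanted by SchoenfliesSplit and EuclideanOrigami.  Idea card
`Cruxes/SchsplitCerf/Ideas/contact-cone-gromov-relend.md` (≈ `contact-isotopy-gromov-cone`, merged by
all three triagers; triage r1-1/2/3: pass).

## The line: Eliashberg's proof of Cerf's theorem, with the disc filling replaced by the tree's
## relative recognition of `ℝ⁴` (Gromov–McDuff, rel end) applied to the SYMPLECTIC CONE

Write `α₀ = ι*λ₀` for the standard contact form of `𝕊³ ⊂ (ℝ⁴, ω₀ = dλ₀)`,
`λ₀_x(v) = ½ ω₀(x, v)`, `ω₀ = stdSymplecticForm` (`dx₀∧dx₁ + dx₂∧dx₃`).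

* `stub_contactRepresentative` (XL; Eliashberg 1992 Thm 2.1.1 = Geiges 2008 Lemma 4.11.1 with
  Thm 4.10.1/4.10.3 + Gray stability, plus the coorientation fix by complex conjugation
  `c ∈ SO(4)`, `c*α₀ = -α₀`): every ORIENTATION-PRESERVING self-diffeomorphism `f` of `𝕊³` is
  diffeotopic to a positive contactomorphism `g`, `g*α₀ = e^u α₀` (`IsStdContacto g u`).  The only
  `Diff(𝕊³)`-free input of contact topology: tightness of `ξ_st` (Bennequin) and uniqueness of the
  tight contact structure on `𝕊³` up to isotopy (characteristic-foliation tomography on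
  `S² × [-1, 1]`), NOT Cerf.  HARDEST STUB.
* `stub_coneSymplectic` (M; pure calculus on `ℝ⁴ ∖ 0`): for such `g, u` the rescaled cone
  `C(x) = ‖x‖ e^{-u(x/‖x‖)/2} g(x/‖x‖)` (`cone g h`, `h = e^{-u/2}`) satisfies `C*λ₀ = λ₀`
  (tangential part: `½ω₀(r h g z, dh(v) g z + h Dg_z v) = r h² (g*α₀)_z(v) = r α₀_z(v)`; radial
  part: `ω₀(g z, g z) = 0`), hence `C*ω₀ = d(C*λ₀) = dλ₀ = ω₀` at every `x ≠ 0`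
  (`IsSymplecticCone g h`, honest Fréchet derivatives).
* `stub_coneChartRelEnd` (M–L; instantiating the named fact): under
  `gromov_recognitionR4_relEnd` (route item `SymplecticOrigami.GromovRecognitionRelEnd` =
  SymplecticCap crux stmt-11009, `Iff.rfl`), a symplectic cone `C = cone ψ h` is the germ at
  infinity of a DIFFEOMORPHISM of `ℝ⁴`: apply the fact to `M = ℝ⁴`, `sf = ω₀`
  (`stdSymplecticMForm`; its four form clauses and `π₂(ℝ⁴) = 0` are `stdModel_hypotheses`),
  `K = {x | ‖x‖·h(x/‖x‖) ≤ 1} = {0} ∪ C⁻¹(B̄(0,1))` (closed and bounded), `R = 1`, end chart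
  `ψ_fact = C` (smooth off `0`), inverse `χ = cone ψ⁻¹ (1/(h ∘ ψ⁻¹))`, ends clause
  `{‖C x‖ ≤ R'} ⊆ B̄(0, R'/min h)`, `BijOn` from the explicit inverse, pullback clause = the cone
  identity read through `mfderiv = fderiv` on `ℝ⁴`; output `Φ : ℝ⁴ ≃ₘ ℝ⁴` with `Φ = C` off a
  compact `K'` (the symplectic half of the conclusion is not used downstream).
* `stub_extendsOverBall_of_coneGerm` (L; differential topology of `ℝ⁴`, no symplectic input): if a
  diffeomorphism `Φ` of `ℝ⁴` agrees with `cone ψ h` (`h > 0` smooth) off a compact set, then `ψ`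
  extends over `𝔻⁴`: the conical rescaling `Φ_λ(x) = Φ(λx)/λ` (`λ` large) agrees with `C` on
  `{‖x‖ ≥ 1}` by degree-one homogeneity, so `Φ_λ(𝔻⁴)` is the star-shaped body
  `{ρ y | ρ ≤ h(ψ⁻¹ y)}`; a radial diffeomorphism `Θ(ρ y) = τ_y(ρ) y` (identity near `0`,
  `τ_y(ρ) = ρ / h(ψ⁻¹ y)` for `log ρ ≥ min log (h ∘ ψ⁻¹) - 1`, interpolated in LOG-radius over an
  interval longer than `max |log h|` so that `τ_y' > 0` — triage r1-3 sharpening) straightens it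
  onto `𝔻⁴`; `Θ ∘ Φ_λ` preserves `𝔻⁴` in both directions and restricts to `ψ` on `𝕊³`;
  conclude by `Diffeomorph.closedBallRestrict` (`ClosedBallSmoothMaps.lean`).
* Composition (kernel-checked, no `sorry` of its own): `contactomorphismsExtend`
  (stubs 2 → 3 → 4), `cerf_extends_of_relEnd` (stub 1 + Cerf's Lemme 2
  `ExtendsOverBall.of_isDiffeotopic` for orientation-preserving `φ`; `φ ∘ ρ` with the hyperplane
  reflection `ρ`, which extends linearly, `extendsOverBall_sphereReflection`, for
  orientation-reversing `φ` — the orientation split demanded by Disproof §4(i)), then the tree's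
  PROVED chain `cerf_twistedSphere_four_of_extends''` (gluing uniqueness; consumes the full gluing
  predicate incl. the cover clause — Disproof §3) to the crux BY NAME: `SchsplitCerf_of`,
  `CerfGammaFour_of`, each with the single admissible hypothesis
  `hG : SymplecticOrigami.GromovRecognitionRelEnd` (route item, registered obligation, already
  staffed as crux stmt-11009 — a DEBT MERGER for the symplectic routes, new debt for
  SchoenfliesSplit alone; honest cost note of the card, accepted by triage).

Disproof.lean (cdisprove cycle 1, NO KILL) honoured: §2 entry point `schsplitCerf_of_extends` is
exactly our exit; §3 `schsplitCerf_false_without_gluing` / `_false_without_cover` — the line uses the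
gluing predicate and the cover through `cerf_twistedSphere_four_of_extends''`
(`nonempty_diffeomorph_of_isTwistedSphere`); §4(i) `not_forall_isDiffeotopicToId_sphere_three` —
stub 1 is stated for orientation-PRESERVING `f` only and proves extension, not isotopy-to-id, the
reversing class is absorbed by a reflection in `cerf_extends_of_relEnd`; §4(iii) (must use `n = 3`)
— stub 1 is 3-dimensional contact topology and stub 3 is the 4-dimensional rel-end recognition
(open in dimension ≥ 6, McDuff–Salamon 2017 Rem 4.5.2 (ix)); §5(ii) leaf not used.  Landed
`Theorems/SchsplitCerf/Negative/*` (RefutationCost, WithoutGluingFalse, WithoutCoverFalse,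
NaiveStrengtheningsFalse): no stub is an instance they refute (no stub drops the gluing/cover
clause or asserts isotopy-to-id of every diffeomorphism).  `ledger negatives --problem
SmoothPoincare4`: none bearing.
-/

noncomputable section

-- the prescribed namespace `Summit.<P>.<Sub>.…` duplicates `SmoothPoincare4` (P = Sub)
set_option linter.dupNamespace false

open scoped Manifold ContDiff Topology
open Set Function Metric
open Literature.Topology.FourManifolds Literature.Geometry.Symplectic

namespace Summit.SmoothPoincare4.SmoothPoincare4.Cruxes.SchsplitCerf.ContactConeGromovRelend

/-- The model `ℝ⁴`. -/
local notation "E4" => EuclideanSpace ℝ (Fin 4)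
/-- The unit 3-sphere `𝕊³ ⊂ ℝ⁴` (Mathlib's analytic manifold, model `𝓡 3`). -/
local notation "𝕊³" => (Metric.sphere (0 : EuclideanSpace ℝ (Fin 4)) 1)

/-! ## §0 The route decls are the Literature names (`Iff.rfl`) -/

/-- The crux decl of route SymplecticOrigami is literally `cerf_twistedSphere_four`. -/
theorem cerfGammaFour_iff :
    Summit.SmoothPoincare4.SmoothPoincare4.Theses.SymplecticOrigami.CerfGammaFour ↔
      cerf_twistedSphere_four :=
  Iff.rfl

/-- The crux decl of route SchoenfliesSplit is literally `cerf_twistedSphere_four`. -/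
theorem schsplitCerf_iff :
    Summit.SmoothPoincare4.SmoothPoincare4.Theses.SchoenfliesSplit.SchsplitCerf ↔
      cerf_twistedSphere_four :=
  Iff.rfl

/-- The route item `GromovRecognitionRelEnd` (stmt-SmoothPoincare4-11009) is literally the
Literature named fact `gromov_recognitionR4_relEnd` (McDuff–Salamon 2017, Rem. 4.5.2 (viii)). -/
theorem gromovRecognitionRelEnd_iff :
    Summit.SmoothPoincare4.SmoothPoincare4.Theses.SymplecticOrigami.GromovRecognitionRelEnd ↔
      gromov_recognitionR4_relEnd :=
  Iff.rfl

/-! ## §1 Vocabulary (three transparent definitions, extrinsic in `ℝ⁴ ⊃ 𝕊³`) -/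

/-- `g` is a **positive contactomorphism** of the standard contact structure of `𝕊³ ⊂ (ℝ⁴, ω₀)`
with conformal factor `e^u`: for the standard contact form `α₀_z(v) = ½ ω₀(z, v)` (tangent vectors
of Mathlib's `𝕊³` read in `ℝ⁴` through the differential of the inclusion), `g*α₀ = e^u α₀` with
`u` smooth.  (Typing of `SketchIdeator1.IsStdContacto`, triage-checked; `g = id, u = 0` is an
instance, `isStdContacto_refl`.) -/
def IsStdContacto (g : 𝕊³ ≃ₘ⟮𝓡 3, 𝓡 3⟯ 𝕊³) (u : 𝕊³ → ℝ) : Prop :=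
  ContMDiff (𝓡 3) 𝓘(ℝ, ℝ) ∞ u ∧
    ∀ (z : 𝕊³) (v : TangentSpace (𝓡 3) z),
      stdSymplecticForm ((g z : 𝕊³) : E4)
          (mfderiv (𝓡 3) 𝓘(ℝ, E4) (fun w : 𝕊³ => ((g w : 𝕊³) : E4)) z v) =
        Real.exp (u z) *
          stdSymplecticForm ((z : 𝕊³) : E4)
            (mfderiv (𝓡 3) 𝓘(ℝ, E4) (fun w : 𝕊³ => ((w : 𝕊³) : E4)) z v)

/-- The **rescaled cone** of a self-map `ψ` of `𝕊³`: `cone ψ h x = ‖x‖ · h(x/‖x‖) · ψ(x/‖x‖)`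
(value `0` at `x = 0`, whatever the junk value of `radialProjection` there).  Degree-one homogeneous:
`cone ψ h (λ x) = λ · cone ψ h x` for `λ > 0`. -/
def cone (ψ : 𝕊³ ≃ₘ⟮𝓡 3, 𝓡 3⟯ 𝕊³) (h : 𝕊³ → ℝ) (x : E4) : E4 :=
  (‖x‖ * h (radialProjection (sphereBasePoint 3) x)) •
    ((ψ (radialProjection (sphereBasePoint 3) x) : 𝕊³) : E4)

/-- `cone ψ h` is a **symplectic cone**: `h` is smooth and positive and the cone preserves `ω₀` at
every `x ≠ 0` (honest Fréchet derivatives; `cone ψ h` is `C^∞` on `ℝ⁴ ∖ 0`).  For `ψ` a positive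
contactomorphism with factor `e^u` this holds with `h = e^{-u/2}` (`stub_coneSymplectic`). -/
def IsSymplecticCone (ψ : 𝕊³ ≃ₘ⟮𝓡 3, 𝓡 3⟯ 𝕊³) (h : 𝕊³ → ℝ) : Prop :=
  ContMDiff (𝓡 3) 𝓘(ℝ, ℝ) ∞ h ∧ (∀ z, 0 < h z) ∧
    ∀ x : E4, x ≠ 0 → ∀ v w : E4,
      stdSymplecticForm (fderiv ℝ (cone ψ h) x v) (fderiv ℝ (cone ψ h) x w) = stdSymplecticForm v w

/-- The cone fixes the origin. -/
@[simp] theorem cone_zero (ψ : 𝕊³ ≃ₘ⟮𝓡 3, 𝓡 3⟯ 𝕊³) (h : 𝕊³ → ℝ) : cone ψ h 0 = 0 := by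
  simp [cone]

/-- Non-vacuity of the vocabulary: the identity is a positive contactomorphism with `u = 0`. -/
theorem isStdContacto_refl : IsStdContacto (Diffeomorph.refl (𝓡 3) 𝕊³ ∞) (fun _ => 0) := by
  refine ⟨contMDiff_const, fun z v => ?_⟩
  have hfun : (fun w : 𝕊³ => (((Diffeomorph.refl (𝓡 3) 𝕊³ ∞) w : 𝕊³) : E4)) =
      fun w : 𝕊³ => ((w : 𝕊³) : E4) := rfl
  rw [hfun, Real.exp_zero, one_mul]
  rfl

/-- Model instance of the cone: for `ψ = id`, `h = 1` the cone is the identity of `ℝ⁴` (so the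
hypotheses of stubs 3–4 are met by `Φ = id`, `K' = ∅`: the stub statements are not vacuous). -/
theorem cone_refl_one (x : E4) : cone (Diffeomorph.refl (𝓡 3) 𝕊³ ∞) (fun _ => (1 : ℝ)) x = x := by
  by_cases hx : x = 0
  · subst hx
    exact cone_zero _ _
  · have h1 : ((Diffeomorph.refl (𝓡 3) 𝕊³ ∞) (radialProjection (sphereBasePoint 3) x) : E4) =
        ‖x‖⁻¹ • x := coe_radialProjection_of_ne_zero _ hx
    simp only [cone, mul_one]
    rw [h1, smul_smul, mul_inv_cancel₀ (norm_ne_zero_iff.2 hx), one_smul]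

/-- Model instance of `IsSymplecticCone`: the identity cone (`ψ = id`, `h = 1`) is symplectic — the
hypothesis of Stub 3 is satisfiable. -/
theorem isSymplecticCone_refl_one :
    IsSymplecticCone (Diffeomorph.refl (𝓡 3) 𝕊³ ∞) (fun _ => (1 : ℝ)) := by
  refine ⟨contMDiff_const, fun _ => one_pos, fun x _ v w => ?_⟩
  have hid : cone (Diffeomorph.refl (𝓡 3) 𝕊³ ∞) (fun _ => (1 : ℝ)) = id := funext cone_refl_one
  rw [hid, fderiv_id]
  rfl

/-- Model instance of Stub 1 at `f = id`: the hypothesis holds for every smooth orientation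
(`Diffeomorph.IsDiffeotopicToId.isOrientationPreserving`) and the conclusion is met by `g = id`,
`u = 0` (`isStdContacto_refl`) — neither side of the stub is vacuous. -/
example (o : SmoothOrientation (𝓡 3) 𝕊³) :
    (Diffeomorph.refl (𝓡 3) 𝕊³ ∞).IsOrientationPreserving o o ∧
      ∃ (g : 𝕊³ ≃ₘ⟮𝓡 3, 𝓡 3⟯ 𝕊³) (u : 𝕊³ → ℝ),
        Diffeomorph.IsDiffeotopic g (Diffeomorph.refl (𝓡 3) 𝕊³ ∞) ∧ IsStdContacto g u := by
  refine ⟨(Diffeomorph.isDiffeotopicToId_refl).isOrientationPreserving o, Diffeomorph.refl (𝓡 3) 𝕊³ ∞, fun _ => 0,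
    ?_, isStdContacto_refl⟩
  rw [Diffeomorph.IsDiffeotopic, Diffeomorph.symm_refl, Diffeomorph.refl_trans]
  exact Diffeomorph.isDiffeotopicToId_refl

/-! ## §2 Registered stubs -/

/-- **Stub 1 — Eliashberg's contact representative (XL; HARDEST).**  Every orientation-preserving
self-diffeomorphism `f` of `𝕊³` is diffeotopic to a POSITIVE contactomorphism `g` of the standard
contact structure, `g*α₀ = e^u α₀`.  Printed: Geiges (2008), Lemma 4.11.1 — `Tf(ξ_st)` is a
positive tight contact structure (tight because `ξ_st` is: Bennequin, or fillable ⇒ tight,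
Cor. 6.5.10), hence isotopic to `ξ_st` (uniqueness of the tight structure on `S³`, Thm 4.10.1 (a) /
4.10.3 = Eliashberg 1992 Thm 2.1.1, via convex-surface tomography on `S² × [-1,1]`, Thm 4.9.4), and
Gray stability (Thm 2.2.2) turns the isotopy of structures into a diffeotopy `f ~ g` with
`Tg(ξ_st) = ξ_st`; if `g` reverses the coorientation (`g*α₀ = -e^u α₀`) replace it by `g ∘ c`,
`c(z₁, z₂) = (z̄₁, z̄₂) ∈ SO(4)` (`c*α₀ = -α₀`, `c|𝕊³` diffeotopic to `id` through rotations).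
No `Diff(𝕊³)`/`Diff(𝔻³ rel ∂)` input anywhere (triage r1-1/2/3: non-circular on the held text).
Why plausibly true: it is a theorem (two printed proofs).  Formal cost: contact structures /
characteristic foliations on Mathlib's `𝕊³` do not exist yet — XL, 3-dimensional, shared toolbox
with the ConvexBisection/SymplecticCap routes.
[cite: Geiges2008, Lemma 4.11.1; Thm 4.10.1] [cite: Eliashberg1992, Thm 2.1.1] -/
theorem stub_contactRepresentative :
    ∀ (o : SmoothOrientation (𝓡 3) 𝕊³) (f : 𝕊³ ≃ₘ⟮𝓡 3, 𝓡 3⟯ 𝕊³),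
      f.IsOrientationPreserving o o →
        ∃ (g : 𝕊³ ≃ₘ⟮𝓡 3, 𝓡 3⟯ 𝕊³) (u : 𝕊³ → ℝ),
          Diffeomorph.IsDiffeotopic g f ∧ IsStdContacto g u := by
  sorry

/-- **Stub 2 — the cone of a positive contactomorphism is symplectic (M; calculus on `ℝ⁴ ∖ 0`).**
If `g*α₀ = e^u α₀` then `C = cone g e^{-u/2}` satisfies `C*λ₀ = λ₀` on `ℝ⁴ ∖ 0`
(`λ₀_x = ½ ω₀(x, ·)`): at `x = r z`, for `v` tangent to the sphere
`½ ω₀(C x, DC_x v) = ½ ω₀(r h g z, dh_z(v) g z + h Dg_z v) = r h² · ½ ω₀(g z, Dg_z v)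
 = r h² e^u α₀_z(v) = r α₀_z(v) = λ₀_x(v)` (`h² e^u = 1`, `ω₀(g z, g z) = 0`), and for the radial
direction both sides vanish.  Taking exterior derivatives of the two equal `1`-forms on the open
set `ℝ⁴ ∖ 0` (in coordinates: `ω₀(DC v, DC w) = ∂_v[λ₀(C)(DC w)] - ∂_w[λ₀(C)(DC v)]`, symmetry of
`D²C`) gives `ω₀(DC_x v, DC_x w) = ω₀(v, w)`.  Smoothness/positivity of `h = e^{-u/2}` are
immediate.  Why plausibly true: an identity (triage r1-2/3 re-derived it by hand).  Formal cost:
`fderiv` of `‖x‖ · h(x/‖x‖) · g(x/‖x‖)` via the chain rule through `radialProjection` and the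
`mfderiv` of `g : 𝕊³ → ℝ⁴`; second-derivative symmetry (`Mathlib` `second_derivative_symmetric`
/ `ContDiffAt.isSymmSndFDerivAt`). [folklore] -/
theorem stub_coneSymplectic :
    ∀ (g : 𝕊³ ≃ₘ⟮𝓡 3, 𝓡 3⟯ 𝕊³) (u : 𝕊³ → ℝ), IsStdContacto g u →
      IsSymplecticCone g (fun z => Real.exp (-(u z) / 2)) := by
  sorry

/-- **Stub 3 — a symplectic cone is the germ at infinity of a diffeomorphism of `ℝ⁴`
(M–L; THE USE OF THE NAMED FACT).**  Under Gromov's recognition of `ℝ⁴` relative at infinity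
(`gromov_recognitionR4_relEnd`, McDuff–Salamon 2017 Rem. 4.5.2 (viii); = route item
`SymplecticOrigami.GromovRecognitionRelEnd`, `gromovRecognitionRelEnd_iff`), for every symplectic
cone `C = cone ψ h` there is a diffeomorphism `Φ` of `ℝ⁴` equal to `C` off a compact set.
Instantiate the fact at `M = ℝ⁴`, `sf = stdSymplecticMForm` (hypotheses 1–4 =
`gromov_recognitionR4_relEnd.stdModel_hypotheses`: `subsingleton_pi_two_euclideanSpace`,
`isSmoothForm_/isClosedForm_stdSymplecticMForm`, `stdSymplecticMForm_nondegenerate`),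
`K = {x | ‖x‖ * h (x/‖x‖) ≤ 1}` (closed: `x ↦ ‖x‖ h(x/‖x‖)` is continuous, `→ 0` at `0` since `h`
is bounded; bounded by `1/min h`), `R = 1`, `ψ_fact = C` (`ContMDiffOn` on `Kᶜ ⊆ {0}ᶜ`:
`contMDiffAt_radialProjection`, `contMDiff_coe_sphere`, smoothness of `ψ`, `h`, `‖·‖` off `0`),
`χ = cone ψ.symm (fun y => (h (ψ.symm y))⁻¹)` (`χ (C (r z)) = r h z · (h z)⁻¹ · z`), ends clause
`K ∪ {‖C x‖ ≤ R'} ⊆ B̄(0, max 1 R' / min h)` (`‖C x‖ = ‖x‖ h(x/‖x‖)`, `min h > 0` on the compact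
sphere), `BijOn C Kᶜ B̄(0,1)ᶜ` from the explicit inverse, `χ ∘ C = id` on `Kᶜ`, and the pullback
clause `ω₀ = C*ω₀` on `Kᶜ` = `IsSymplecticCone` read through `stdSymplecticMForm_apply` and
`mfderiv = fderiv` on the model space.  Keep only the second half of the conclusion.
Why plausibly true: routine instantiation (triage r1-2 (a), r1-3 checked each clause).
[cite: McDuffSalamon2017, Rem. 4.5.2 (viii)] -/
theorem stub_coneChartRelEnd :
    gromov_recognitionR4_relEnd →
      ∀ (ψ : 𝕊³ ≃ₘ⟮𝓡 3, 𝓡 3⟯ 𝕊³) (h : 𝕊³ → ℝ), IsSymplecticCone ψ h →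
        ∃ Φ : E4 ≃ₘ⟮𝓡 4, 𝓡 4⟯ E4, ∃ K' : Set E4, IsCompact K' ∧
          ∀ x : E4, x ∉ K' → Φ x = cone ψ h x := by
  sorry

/-- **Stub 4 — conical rescaling and radial straightening (L; differential topology of `ℝ⁴`).**
If a diffeomorphism `Φ` of `ℝ⁴` agrees with `cone ψ h` (`h` smooth, positive) off a compact set
`K'`, then `ψ` extends to a diffeomorphism of `𝔻⁴`.  Choose `λ > 0` with `K' ⊆ B(0, λ)`; the
conjugate `Φ_λ(x) = λ⁻¹ Φ(λ x)` is a diffeomorphism of `ℝ⁴` equal to `C = cone ψ h` on `{1 ≤ ‖x‖}`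
(`C(λx) = λ C(x)`), so `Φ_λ(𝔻⁴) = ℝ⁴ ∖ C({1 < ‖x‖}) = {0} ∪ {ρ y | 0 < ρ ≤ k y}`,
`k := h ∘ ψ.symm` (a star-shaped body; `‖C(r z)‖ = r h z`, direction `ψ z`).  Let
`Θ(ρ y) = τ_y(ρ) y` (`y ∈ 𝕊³`, `ρ > 0`; `Θ 0 = 0`) with `log τ_y(e^s) = s - β(s) log k(y)`, `β` a
smooth step `= 0` for `s ≤ s₀`, `= 1` for `s ≥ s₁ := min log k - 1`, and `s₁ - s₀ > sup|β'|⁻¹…`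
chosen so that `sup β' · max |log k| < 1`: then `τ_y' > 0`, `Θ = id` on `B(0, e^{s₀})` (smooth at
`0`), `Θ` is a diffeomorphism of `ℝ⁴` (radial, with the explicit inverse of the same form), and
`τ_y(k y) = 1`, so `Θ` maps the star-shaped body onto `𝔻⁴`.  Hence `G := Θ ∘ Φ_λ` satisfies
`MapsTo G 𝔻⁴ 𝔻⁴`, `MapsTo G⁻¹ 𝔻⁴ 𝔻⁴` and `G z = τ_{ψ z}(h z) ψ z = ψ z` on `𝕊³`; conclude with
`Diffeomorph.closedBallRestrict G` (`ClosedBallSmoothMaps.lean`; `𝓡 4 = 𝓘(ℝ, ℝ⁴)`) and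
`Subtype.ext`.  Why plausibly true: elementary (triage r1-1/2/3 hand-checked, incl. the
log-radius monotonicity caveat).  Formal cost: smoothness of `Θ` (polar-free: write
`Θ x = θ(x) • x` with `θ` smooth on `ℝ⁴ ∖ 0` and `= 1` near `0`), the image computation, L. [folklore] -/
theorem stub_extendsOverBall_of_coneGerm :
    ∀ (ψ : 𝕊³ ≃ₘ⟮𝓡 3, 𝓡 3⟯ 𝕊³) (h : 𝕊³ → ℝ), ContMDiff (𝓡 3) 𝓘(ℝ, ℝ) ∞ h → (∀ z, 0 < h z) →
      ∀ (Φ : E4 ≃ₘ⟮𝓡 4, 𝓡 4⟯ E4) (K' : Set E4), IsCompact K' →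
        (∀ x : E4, x ∉ K' → Φ x = cone ψ h x) → ExtendsOverBall 3 ψ := by
  sorry

/-- Sanity instance of Stub 4's hypotheses and conclusion: `ψ = id` (with `Φ = id`, `K' = ∅`). -/
example : ExtendsOverBall 3 (Diffeomorph.refl (𝓡 3) 𝕊³ ∞) :=
  stub_extendsOverBall_of_coneGerm _ (fun _ => (1 : ℝ)) contMDiff_const (fun _ => one_pos)
    (Diffeomorph.refl (𝓡 4) E4 ∞) ∅ isCompact_empty (fun x _ => (cone_refl_one x).symm)


/-! ## §3 Composition (kernel-checked; no `sorry` below this line) -/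

/-- **Positive contactomorphisms of `(𝕊³, ξ_st)` extend over `𝔻⁴`** (Geiges 2008 Prop. 4.11.2,
here via the cone + rel-end recognition instead of the disc filling): stubs 2 → 3 → 4. -/
theorem contactomorphismsExtend (hG : gromov_recognitionR4_relEnd) (g : 𝕊³ ≃ₘ⟮𝓡 3, 𝓡 3⟯ 𝕊³)
    (u : 𝕊³ → ℝ) (hgu : IsStdContacto g u) : ExtendsOverBall 3 g := by
  have hcone : IsSymplecticCone g (fun z => Real.exp (-(u z) / 2)) := stub_coneSymplectic g u hgu
  obtain ⟨Φ, K', hK', hΦ⟩ := stub_coneChartRelEnd hG g _ hcone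
  exact stub_extendsOverBall_of_coneGerm g _ hcone.1 hcone.2.1 Φ K' hK' hΦ

/-- **`Γ₄ = 0` in extension form from the four stubs and the named fact** (Geiges 2008 §1.7.1:
sweep out the isotopy `f ~ g` over a collar = Cerf's Lemme 2 `ExtendsOverBall.of_isDiffeotopic`;
orientation-reversing `φ`: compose with a hyperplane reflection, which extends linearly — the
orientation split of Disproof §4(i)).  Ported from the kernel-checked
`SketchIdeator1.cerf_extends_of_contact`. -/
theorem cerf_extends_of_relEnd (hG : gromov_recognitionR4_relEnd) :
    cerf_diffeomorph_sphere_three_extends_ball := by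
  intro φ
  obtain ⟨o, -⟩ := exists_smoothOrientation_sphere 3
  haveI : ConnectedSpace 𝕊³ := by
    refine isConnected_iff_connectedSpace.mp (isConnected_sphere ?_ 0 zero_le_one)
    rw [← Module.finrank_eq_rank, finrank_euclideanSpace_fin]
    norm_num
  -- the orientation-preserving case, for any `θ`
  have hpos : ∀ θ : 𝕊³ ≃ₘ⟮𝓡 3, 𝓡 3⟯ 𝕊³, θ.IsOrientationPreserving o o → ExtendsOverBall 3 θ := by
    intro θ hθ
    obtain ⟨g, u, hg, hu⟩ := stub_contactRepresentative o θ hθ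
    exact (contactomorphismsExtend hG g u hu).of_isDiffeotopic hg
  rcases Diffeomorph.isOrientationPreserving_or_isOrientationReversing_holds φ (by simp) o o
    with hφ | hφ
  · exact hpos φ hφ
  · set v : 𝕊³ := sphereBasePoint 3
    have hρ : IsOrientationPreserving o (-o) ⇑(sphereReflection v) :=
      sphereReflection_isOrientationReversing_of_ne_zero three_ne_zero v o
    have hφ' : IsOrientationPreserving (-o) o ⇑φ := by
      rw [← isOrientationPreserving_neg_neg_iff, neg_neg]
      exact hφ
    have hcomp : ((sphereReflection v).trans φ).IsOrientationPreserving o o := by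
      show IsOrientationPreserving o o ⇑((sphereReflection v).trans φ)
      rw [Diffeomorph.coe_trans]
      exact IsOrientationPreserving.comp_holds hφ' hρ (φ.mdifferentiable (by simp))
        ((sphereReflection v).mdifferentiable (by simp))
        (fun y => φ.det_mfderiv_ne_zero (by simp) y)
        (fun x => (sphereReflection v).det_mfderiv_ne_zero (by simp) x)
    have hext : ExtendsOverBall 3 ((sphereReflection v).trans φ) := hpos _ hcomp
    have key : φ = (sphereReflection v).symm.trans ((sphereReflection v).trans φ) :=
      Diffeomorph.ext fun x => by
        simp only [Diffeomorph.coe_trans, Function.comp_apply, Diffeomorph.apply_symm_apply]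
    rw [key]
    exact (extendsOverBall_sphereReflection v).symm.trans hext

/-- **THE SKELETON THEOREM for route SchoenfliesSplit** — concludes the crux `SchsplitCerf` BY NAME;
its only hypothesis is the registered route item `GromovRecognitionRelEnd` (stmt-11009); the four
stubs are used by name inside `cerf_extends_of_relEnd`; the last arrow is the tree's PROVED
`cerf_twistedSphere_four_of_extends''` (gluing uniqueness; Disproof §3 honoured). -/
theorem SchsplitCerf_of
    (hG : Summit.SmoothPoincare4.SmoothPoincare4.Theses.SymplecticOrigami.GromovRecognitionRelEnd) :
    Summit.SmoothPoincare4.SmoothPoincare4.Theses.SchoenfliesSplit.SchsplitCerf :=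
  cerf_twistedSphere_four_of_extends'' (cerf_extends_of_relEnd (gromovRecognitionRelEnd_iff.1 hG))

/-- **THE SKELETON THEOREM for the primary route SymplecticOrigami** — concludes `CerfGammaFour`
(the same item stmt-SmoothPoincare4-8758) BY NAME from the same hypothesis. -/
theorem CerfGammaFour_of
    (hG : Summit.SmoothPoincare4.SmoothPoincare4.Theses.SymplecticOrigami.GromovRecognitionRelEnd) :
    Summit.SmoothPoincare4.SmoothPoincare4.Theses.SymplecticOrigami.CerfGammaFour :=
  cerf_twistedSphere_four_of_extends'' (cerf_extends_of_relEnd (gromovRecognitionRelEnd_iff.1 hG))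

/-- Over the Literature name directly: between this file and a proof of `Γ₄ = 0` stand exactly the
four `sorry`s above and Gromov's rel-end recognition theorem. -/
example (hG : gromov_recognitionR4_relEnd) : cerf_twistedSphere_four :=
  cerf_twistedSphere_four_of_extends'' (cerf_extends_of_relEnd hG)

end Summit.SmoothPoincare4.SmoothPoincare4.Cruxes.SchsplitCerf.ContactConeGromovRelend

end
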